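import Summits.BirchSwinnertonDyer.Rank1Residual.X11b.TorsionLevelCohomology
import HarnessLib

/-!
# X11b, route R1 — `E[p^k] ↪ E[p^∞]` as an intertwining map and the three level facts on `H¹`,
# over `K` and over every `K`-field (completions)

HONEST FRAMING (cell `b2b-bsdres`, run/shared/lean/b2b/bsd-rank1-residual/, verbatim in every
file): the goal of the cell is to DELETE the COMBINATION-SHAPED residual classes of the
Birch–Swinnerton-Dyer formula for ALL analytic-rank `≤ 1` elliptic curves over `ℚ` — "full BSD
formula for every rank `≤ 1` curve in class `C`" assembled STRICTLY from published theorems — so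
that the rank-`≤ 1` remainder becomes exactly the CONSTRUCTION-SHAPED classes, which are TYPED
(missing-input `Prop`s), NOT attempted. This is not "finishing BSD". Sub-cell
`b2b-bsdres-multr1-p1` (X11b, route R1 = Castella 2018 Thm. A re-proved along the author's
erratum); a RESEARCH ROUTE; no claim beyond the stated class; X11b stays CONSTRUCTION-SHAPED;
nothing here changes a label; no named fact is minted (one definition with body — the inclusion
`E[p^k] ↪ E[p^∞]` as a `Γ_K`-intertwining map — and theorems; no `sorry`).

## What is here

The generic level facts of `TorsionLevelCohomology` (kernel = connecting classes of invariant
points; image = the `n`-torsion; injectivity without invariant points) specialised to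
`i = primaryInclusion W p k : E[p^k] ↪ E[p^∞]` (modules `W.torsionGaloisModule (p^k)` and
`LocBridge.primaryGaloisModule W p`) over the base field `K`, and to its restriction
`(primaryInclusion W p k).restrictField E` to any `K`-field `E` — the completions `K_v`, where the
restricted modules are discrete Galois modules over `K_v` and the kernel IS the propagated zero
condition of Howard Def. 2.1.1 (`map_primaryInclusion_restrictField_eq_zero_iff`):

* `Levels.primaryInclusion`, `primaryInclusion_injective`, `pow_nsmul_geomTorsion_eq_zero`,
  `exists_primaryInclusion_eq_of_nsmul_eq_zero`, `exists_pow_nsmul_eq_geomPrimaryTorsion`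
  (`E[p^∞]` is `p^k`-divisible, from the tree's divisibility of `E(K̄)`);
* over `K`: `map_primaryInclusion_injective` (`E[p^∞]^{Γ_K} = 0 ⟹` injective),
  `map_primaryInclusion_eq_zero_iff`, `mem_range_map_primaryInclusion_iff` (image `= [p^k]`);
* over a `K`-field `E`: `map_primaryInclusion_restrictField_injective`,
  `map_primaryInclusion_restrictField_eq_zero_iff`, `mem_range_map_primaryInclusion_restrictField_iff`.

References: [GreenbergLNM1716] §2 p. 63, §5 proof of Prop. 5.8; [Howard2004HeegnerKolyvagin]
Def. 2.1.1; [JetchevSkinnerWan2017] §3.3; Silverman, *AEC*, VIII.§2.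
-/

noncomputable section

open scoped Classical

open CategoryTheory NumberField IsDedekindDomain Field
open Literature.NumberTheory.EllipticCurves
open Literature.NumberTheory.GaloisRepresentations
open scoped ContRepresentation

universe u

namespace Summit.BirchSwinnertonDyer.Rank1Residual.X11b.Levels

/-! ## §4. `E[p^k] ↪ E[p^∞]` as an intertwining map, over `K` and over every `K`-field -/

section Curve

variable {K : Type u} [Field K] (W : WeierstrassCurve K) (p k : ℕ)

/-- `E[p^k] ⊆ E[p^∞]`. [folklore] -/
theorem geomTorsion_pow_le_geomPrimaryTorsion :
    W.geomTorsion ((p ^ k : ℕ) : ℤ) ≤ W.geomPrimaryTorsion p := fun P hP ↦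
  (AddCommGroup.mem_primaryComponent).mpr ⟨k, by
    rw [← natCast_zsmul]; exact (W.mem_geomTorsion_iff _ P).mp hP⟩

/-- **The inclusion `E[p^k] ↪ E[p^∞]`** as a continuous `Γ_K`-intertwining map of the discrete
Galois modules `W.torsionGaloisModule (p^k)` and `LocBridge.primaryGaloisModule W p` (the map
inducing `H¹(K, E[p^k]) → H¹(K, E[p^∞])` of Greenberg LNM 1716 §5, proof of Prop. 5.8, and its
local analogues). [folklore] -/
def primaryInclusion :
    (W.torsionGaloisModule ((p ^ k : ℕ) : ℤ)).toContRepresentation →ⁱL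
      (LocBridge.primaryGaloisModule W p).toContRepresentation where
  toContinuousLinearMap :=
    ⟨(AddSubgroup.inclusion (geomTorsion_pow_le_geomPrimaryTorsion W p k)).toIntLinearMap,
      continuous_of_discreteTopology⟩
  isIntertwining' σ := by
    ext P
    rfl

/-- Unfolding `primaryInclusion` on underlying points. [folklore] -/
@[simp]
theorem coe_primaryInclusion_apply (P : W.geomTorsion ((p ^ k : ℕ) : ℤ)) :
    ((primaryInclusion W p k P : W.geomPrimaryTorsion p) : W.geomPoints) = P :=
  rfl

/-- `primaryInclusion` is injective. [folklore] -/
theorem primaryInclusion_injective : Function.Injective (primaryInclusion W p k) :=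
  fun P Q h ↦ Subtype.ext (by
    have h' := congrArg (fun x : W.geomPrimaryTorsion p ↦ (x : W.geomPoints)) h
    simpa only [coe_primaryInclusion_apply] using h')

/-- `E[p^k]` is killed by `p^k`. [folklore] -/
theorem pow_nsmul_geomTorsion_eq_zero (P : W.geomTorsion ((p ^ k : ℕ) : ℤ)) : p ^ k • P = 0 :=
  Subtype.ext (by
    rw [AddSubgroupClass.coe_nsmul, ZeroMemClass.coe_zero, ← natCast_zsmul]
    exact (W.mem_geomTorsion_iff _ (P : W.geomPoints)).mp P.2)

/-- `range (E[p^k] ↪ E[p^∞]) ⊇ E[p^∞][p^k]`. [folklore] -/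
theorem exists_primaryInclusion_eq_of_nsmul_eq_zero (Q : W.geomPrimaryTorsion p)
    (hQ : p ^ k • Q = 0) : ∃ P : W.geomTorsion ((p ^ k : ℕ) : ℤ), primaryInclusion W p k P = Q :=
  ⟨⟨(Q : W.geomPoints), (W.mem_geomTorsion_iff _ _).mpr (by
      rw [natCast_zsmul, ← AddSubgroupClass.coe_nsmul, hQ, ZeroMemClass.coe_zero])⟩,
    Subtype.ext rfl⟩

variable (E : Type u) [Field E] [Algebra K E]

/-- The restriction `(E[p^k] ↪ E[p^∞])|_{Γ_E}` to a `K`-field `E` (e.g. a completion `K_v`) is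
injective (same underlying map). [folklore] -/
theorem primaryInclusion_restrictField_injective :
    Function.Injective ((primaryInclusion W p k).restrictField E) :=
  primaryInclusion_injective W p k

/-- … and has range `⊇ E[p^∞][p^k]` (same underlying map). [folklore] -/
theorem exists_primaryInclusion_restrictField_eq_of_nsmul_eq_zero (Q : W.geomPrimaryTorsion p)
    (hQ : p ^ k • Q = 0) :
    ∃ P : W.geomTorsion ((p ^ k : ℕ) : ℤ), (primaryInclusion W p k).restrictField E P = Q :=
  exists_primaryInclusion_eq_of_nsmul_eq_zero W p k Q hQ

variable [hp : Fact p.Prime]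

/-- `E[p^∞]` is `p^k`-divisible for an elliptic curve, granted the divisibility of `E(K̄)`
(iterate the tree's `exists_nsmul_eq_geomPrimaryTorsion`).
Greenberg LNM 1716 §2 p. 62 ("as `E(F̄)` is divisible"). [folklore] -/
theorem exists_pow_nsmul_eq_geomPrimaryTorsion (hdiv : W.zsmul_geomPoints_surjective) [W.IsElliptic]
    (Q : W.geomPrimaryTorsion p) : ∃ Q' : W.geomPrimaryTorsion p, p ^ k • Q' = Q := by
  induction k generalizing Q with
  | zero => exact ⟨Q, by rw [pow_zero, one_smul]⟩
  | succ k ih =>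
    obtain ⟨Q₁, rfl⟩ := W.exists_nsmul_eq_geomPrimaryTorsion p hdiv Q
    obtain ⟨Q₂, rfl⟩ := ih Q₁
    exact ⟨Q₂, by rw [pow_succ, mul_smul, smul_comm]⟩

end Curve

/-! ## §5. The three facts for `H¹(K, E[p^k]) → H¹(K, E[p^∞])` and for every `K`-field `E` -/

section Specialised

variable {K : Type u} [Field K] (W : WeierstrassCurve K) (p k : ℕ)

/-- **Over `K`: `H¹(K, E[p^k]) → H¹(K, E[p^∞])` is injective when `E[p^∞]^{Γ_K} = 0`** (e.g.
`E(K)[p] = 0`). [cite: GreenbergLNM1716, §2 p. 63] -/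
theorem map_primaryInclusion_injective
    (hΓ : ∀ Q : W.geomPrimaryTorsion p,
      (∀ σ : absoluteGaloisGroup K, LocBridge.primaryGaloisModule W p σ Q = Q) → Q = 0) :
    Function.Injective (galoisCohomology.map (primaryInclusion W p k) 1) :=
  map_one_injective_of_forall_fixed_eq_zero (exists_primaryInclusion_eq_of_nsmul_eq_zero W p k)
    (primaryInclusion_injective W p k) (pow_nsmul_geomTorsion_eq_zero W p k) hΓ

/-- **Over `K`: the kernel of `H¹(K, E[p^k]) → H¹(K, E[p^∞])` consists of the connecting classes
`δ(Q)`, `p^k • Q ∈ E[p^∞]^{Γ_K} = E(K)[p^∞]`** (the Kummer image of `E(K)[p^∞]`).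
[cite: GreenbergLNM1716, §5 proof of Prop. 5.8] -/
theorem map_primaryInclusion_eq_zero_iff
    (c : galoisCohomology (W.torsionGaloisModule ((p ^ k : ℕ) : ℤ)) 1) :
    galoisCohomology.map (primaryInclusion W p k) 1 c = 0 ↔
      ∃ (Q : W.geomPrimaryTorsion p)
        (hQ : ∀ σ : absoluteGaloisGroup K,
          LocBridge.primaryGaloisModule W p σ (p ^ k • Q) = p ^ k • Q),
        c = connectingClass (primaryInclusion W p k) (p ^ k)
          (exists_primaryInclusion_eq_of_nsmul_eq_zero W p k)
          (primaryInclusion_injective W p k) Q hQ :=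
  map_one_eq_zero_iff_exists _ (pow_nsmul_geomTorsion_eq_zero W p k) c

/-- **Over `K`: the image of `H¹(K, E[p^k]) → H¹(K, E[p^∞])` is `H¹(K, E[p^∞])[p^k]`** (for `W`
elliptic, granted the divisibility of `E(K̄)`). [cite: GreenbergLNM1716, §5 proof of Prop. 5.8] -/
theorem mem_range_map_primaryInclusion_iff [Fact p.Prime] (hdiv : W.zsmul_geomPoints_surjective)
    [W.IsElliptic] (x : galoisCohomology (LocBridge.primaryGaloisModule W p) 1) :
    x ∈ (galoisCohomology.map (primaryInclusion W p k) 1).range ↔ p ^ k • x = 0 :=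
  mem_range_map_one_iff (exists_primaryInclusion_eq_of_nsmul_eq_zero W p k)
    (primaryInclusion_injective W p k) (pow_nsmul_geomTorsion_eq_zero W p k)
    (exists_pow_nsmul_eq_geomPrimaryTorsion W p k hdiv) x

variable (E : Type u) [Field E] [Algebra K E]

/-- **Over a `K`-field `E` (a completion): `H¹(E, E[p^k]) → H¹(E, E[p^∞])` (restricted modules) is
injective when `E[p^∞]^{Γ_E} = 0`** (e.g. `E(K_v)[p] = 0`, the erratum's hypothesis (iv) at
`v = 𝔭`). [cite: GreenbergLNM1716, §2 p. 63] -/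
theorem map_primaryInclusion_restrictField_injective
    (hΓ : ∀ Q : W.geomPrimaryTorsion p,
      (∀ σ : absoluteGaloisGroup E,
        GaloisRep.restrictField E (LocBridge.primaryGaloisModule W p) σ Q = Q) → Q = 0) :
    Function.Injective (galoisCohomology.map ((primaryInclusion W p k).restrictField E) 1) :=
  map_one_injective_of_forall_fixed_eq_zero
    (ρB := GaloisRep.restrictField E (LocBridge.primaryGaloisModule W p))
    (exists_primaryInclusion_restrictField_eq_of_nsmul_eq_zero W p k E)
    (primaryInclusion_restrictField_injective W p k E) (pow_nsmul_geomTorsion_eq_zero W p k) hΓ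

/-- **Over a `K`-field `E`: the kernel of `H¹(E, E[p^k]) → H¹(E, E[p^∞])` consists of the
connecting classes `δ(Q)` of the points `Q ∈ E[p^∞]` with `p^k • Q ∈ E[p^∞]^{Γ_E}`** — the
PROPAGATED zero condition `ker (H¹(E, E[p^k]) → H¹(E, E[p^∞]))` of Howard Def. 2.1.1 is the
image of the invariants `E[p^∞]^{Γ_E}` under the Kummer connecting map.
[cite: Howard2004HeegnerKolyvagin, Def. 2.1.1 (arXiv:1202.6340 p. 5)]
[cite: GreenbergLNM1716, §5 proof of Prop. 5.8] -/
theorem map_primaryInclusion_restrictField_eq_zero_iff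
    (c : galoisCohomology (GaloisRep.restrictField E (W.torsionGaloisModule ((p ^ k : ℕ) : ℤ))) 1) :
    galoisCohomology.map ((primaryInclusion W p k).restrictField E) 1 c = 0 ↔
      ∃ (Q : W.geomPrimaryTorsion p)
        (hQ : ∀ σ : absoluteGaloisGroup E,
          GaloisRep.restrictField E (LocBridge.primaryGaloisModule W p) σ (p ^ k • Q) = p ^ k • Q),
        c = connectingClass ((primaryInclusion W p k).restrictField E) (p ^ k)
          (exists_primaryInclusion_restrictField_eq_of_nsmul_eq_zero W p k E)
          (primaryInclusion_restrictField_injective W p k E) Q hQ :=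
  map_one_eq_zero_iff_exists _ (pow_nsmul_geomTorsion_eq_zero W p k) c

/-- **Over a `K`-field `E`: the image of `H¹(E, E[p^k]) → H¹(E, E[p^∞])` is the `p^k`-torsion**
(for `W` elliptic, granted the divisibility of `E(K̄)`). [cite: GreenbergLNM1716, §5 proof of Prop. 5.8] -/
theorem mem_range_map_primaryInclusion_restrictField_iff [Fact p.Prime]
    (hdiv : W.zsmul_geomPoints_surjective) [W.IsElliptic]
    (x : galoisCohomology (GaloisRep.restrictField E (LocBridge.primaryGaloisModule W p)) 1) :
    x ∈ (galoisCohomology.map ((primaryInclusion W p k).restrictField E) 1).range ↔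
      p ^ k • x = 0 :=
  mem_range_map_one_iff (ρB := GaloisRep.restrictField E (LocBridge.primaryGaloisModule W p))
    (exists_primaryInclusion_restrictField_eq_of_nsmul_eq_zero W p k E)
    (primaryInclusion_restrictField_injective W p k E) (pow_nsmul_geomTorsion_eq_zero W p k)
    (exists_pow_nsmul_eq_geomPrimaryTorsion W p k hdiv) x

end Specialised

end Summit.BirchSwinnertonDyer.Rank1Residual.X11b.Levels

end
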